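import Summits.QuantumFields.BalabanUV.Beta.GAN24.MultiplierZeroMass

/-!
# `BalabanUV.Beta.GAN24.MultiplierVertexBondSum` — binder row G-an2-4 / (CONV-C), W-slot, road «W3» (SKELETON-W3 v0.2 §7.2): THE
# MULTIPLIER VERTEX OF an2's CARRIER HAS ZERO TOTAL BOND SUM — `Σ'_y vertexOfM K N M μ y x z a b = 0` POINTWISE, for every packed
# kernel `K` whose multiplier columns `colM` have zero bond mass (an4's `KInvStep Lc j`, raw or dressed: `GAN24/MultiplierZeroMass`) and
# every table `M` with a summable envelope in its coarse index (an2's `VertexFamily`, and the `(κ, u)`-slices of a `LocStencilFM` table)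
# (idle leaf seat `b2b-balaban-gan24-formalise-leaf-14`, gen 22, invitation «W3-ZB*»; name provisional — the row owner may re-home it)

NOT IN PRINT; OUR BOOKKEEPING.  HONEST FRAMING (cell contract, verbatim): «discharging `BetaPertH` makes Bałaban's UV stability
UNCONDITIONAL — a real constructive-QFT result; it is NOT the continuum limit and NOT the Clay problem.»  HONEST DEPENDENCY (verbatim):
«continuum YM on T⁴ ⇐ BetaPertH ∧ nine spine estimates (0/9 proved); BetaPertH ⇐ (D1) ∧ (D4) ∧ CAP+tail; G-an2-4 gates asym, D1 and
NE2/3/4.»  [folklore] Fubini bookkeeping (one absolutely convergent double lattice sum, `HasSum.prod_fiberwise` in both orders) over TREE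
objects BY NAME — an2's `SecondOrderResponse.vertexOfM` / `colM` / `InterLevelTransport.cwsum_apply`, `ExpKernelCalculus.Decays` /
`VertexFamily`, `SecondOrderResponse.LocStencilFM`, and `GAN24/MultiplierZeroMass` (the zero `colM` masses = fact (S2c)); no estimate about
Bałaban's tables, no cited fact, no `def`, no `def … : Prop`, no wall binder; 0 sorry.  Discharges NOTHING of «T2Shape» / «T2SupRate» /
(hW, hWall); NOT «W-slot closed», NEVER «G-an2-4 closed»; NOT BetaPertH, NOT continuum, NOT Clay.

WHY (the located use).  In the row owner's zero-mode calculus (SKELETON-W3 v0.2 §7.2) the MIXED channel `mixOfK K̃ M̃₂`, the multiplier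
half `vertexOfM K̃ M̃` of `dM` inside the second-response piece and the exchange trees all «die on (S2c)» because «their weights are
`colM` = K̃_mm-columns on a constant».  The literal kernel statement behind that sentence is: summed over the coarse BOND position `y`,
the multiplier vertex `vertexOfM K N M μ y = Σ_ρ Σ'_w colM K N μ y ρ w • M ρ w` vanishes entry by entry, because for each `(ρ, w)` the
bond sum `Σ_y colM K N μ y ρ w` is `0` (`MultiplierZeroMass.hasSum_colM_KInvStep_bond`) and the double family `(y, w)` converges absolutely.
THIS FILE proves exactly that, with the table's envelope as a POINTWISE hypothesis so that both an2's `VertexFamily` tables (the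
multiplier Hessian `M1 = cΛ • hessFF` and its dressed version) and the slices `M₂ κ u` of a `LocStencilFM` table (the mixed table `mixFF`
inside `mixOfK`) are covered:
* §1 `hasSum_vertexOfM_bond_of_bound` (GENERIC `K`, `N ≥ 1`): `Decays K C m` (`0 < m`), zero bond masses `∀ μ ρ w, HasSum (fun y ↦ colM K N μ y ρ w) 0`,
  and at the entry `(x, z, a, b)` an envelope `|M ρ w x z a b| ≤ CM·e^{−δ|p − N•w|₁}` (`0 < δ`, any centre `p`) ⟹
  `HasSum (fun y ↦ vertexOfM K N M μ y x z a b) 0`; corollaries `hasSum_vertexOfM_bond` (`VertexFamily M N CM δ`, centre `x`) and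
  `hasSum_vertexOfM_bond_locStencilFM` (the slice `M₂ κ u` of a `LocStencilFM N M₂ C₂ δ` table, centre `u`); `tsum` forms.
* §2 THE STEP INSTANCES: `K := KInvStep Lc j` (`hasSum_vertexOfM_KInvStep_bond`, `…_locStencilFM`) and the dressed
  `K := unitK s_f s_m (KInvStep Lc j)` of the wall's units (`hasSum_vertexOfM_unitK_KInvStep_bond`, `…_locStencilFM`), hypotheses on `K`
  discharged BY NAME (`OneStepKernelFamily.decays_KInvStep`, `HessKerDressedUnits.decays_unitK`, `MultiplierZeroMass.hasSum_colM_*`).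
NOT here: the outer Fubini through `vertexOfK`'s field rows that turns this into `Σ_{y′} mixOfK K N M₂ μ y ν y′ = 0`, and the zero-mode
functional itself (leaf-02-g15's «T2-ZERO-MODE-KERNEL*»); nothing of an1's concrete tables is read.
-/

noncomputable section

open Finset
open scoped BigOperators

namespace Summit.QuantumFields.BalabanUV.Beta.GAN24.MultiplierVertexBondSum

open Literature.MathematicalPhysics.QuantumFieldTheory
open Literature.MathematicalPhysics.QuantumFieldTheory.Balaban1983to89
open Literature.MathematicalPhysics.QuantumFieldTheory.Balaban1983to89.Beta
open AffineAveraging (Site)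
open B12Sec2to5 (l1 l1_nonneg)
open ExpKernelCalculus (MKer Decays BiLoc VertexFamily Zl summable_exp_shift tsum_exp_shift)
open OneStepResolventKernel (Fib)
open LatticeForm (quo)
open OneStepKernelFamily (KInvStep decays_KInvStep)
open BalabanStepJetsSucc (l1_sub_le_l1_smul_sub)
open InterLevelTransport (cwsum_apply)
open SecondOrderResponse (colM vertexOfM LocStencilFM)
open Summit.QuantumFields.BalabanUV.Beta.HessKerDressedUnits (unitK decays_unitK)
open Summit.QuantumFields.BalabanUV.Beta.GAN24.MultiplierZeroMass (hasSum_colM_KInvStep_bond hasSum_colM_unitK_KInvStep_bond)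

variable {d : ℕ}

/-! ## §1 The generic bond-sum lemma -/

section Generic

variable {N : ℕ} [NeZero N]

/-- [folklore] `y ↦ N•y` is injective on the lattice (`N ≥ 1`). -/
theorem zsmul_injective : Function.Injective (fun y : Site (d + 1) => (N : ℤ) • y) := by
  intro y y' h
  have := congrArg (quo N) h
  simpa only [OneStepResolventKernel.quo_zsmul] using this

/-- [folklore] The coarse-indexed exponential envelope is summable: `Σ_w e^{−δ|p − N•w|₁} < ∞` (a subseries of `Σ_v e^{−δ|p − v|₁}`). -/
theorem summable_exp_coarse {δ : ℝ} (hδ : 0 < δ) (p : Site (d + 1)) :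
    Summable (fun w : Site (d + 1) => Real.exp (-δ * l1 (p - (N : ℤ) • w))) :=
  (summable_exp_shift hδ p).comp_injective zsmul_injective

/-- [folklore] The multiplier column of a decaying kernel, bounded in FINE units of the index difference:
`|colM K N μ y ρ w| ≤ C·e^{−m|w − y|₁}` (`|N•w − N•y|₁ ≥ |w − y|₁` for `N ≥ 1`). -/
theorem abs_colM_le_fine {K : MKer (d + 1) (Fib d)} {C m : ℝ} (hK : Decays K C m) (hm : 0 ≤ m) (μ : Fin (d + 1))
    (y : Site (d + 1)) (ρ : Fin (d + 1)) (w : Site (d + 1)) :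
    |colM K N μ y ρ w| ≤ C * Real.exp (-m * l1 (w - y)) := by
  have hC : 0 ≤ C := hK.nonneg (Sum.inl 0)
  have hN : 1 ≤ N := Nat.one_le_iff_ne_zero.2 (NeZero.ne N)
  refine (hK _ _ _ _).trans (mul_le_mul_of_nonneg_left ?_ hC)
  rw [Real.exp_le_exp]
  have h := l1_sub_le_l1_smul_sub (d := d) hN w y
  nlinarith

/-- [folklore] The envelope of the double family is summable on `ℤ^{d+1} × ℤ^{d+1}` (outer index the coarse position `w`):
`Σ_{(w,y)} CM e^{−δ|p−N•w|₁} · C e^{−m|w−y|₁} = CM·C·Zl(m)·Σ_w e^{−δ|p−N•w|₁} < ∞`. -/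
theorem summable_envelope {C m CM δ : ℝ} (hC : 0 ≤ C) (hm : 0 < m) (hCM : 0 ≤ CM) (hδ : 0 < δ) (p : Site (d + 1)) :
    Summable (fun q : Site (d + 1) × Site (d + 1) =>
      (CM * Real.exp (-δ * l1 (p - (N : ℤ) • q.1))) * (C * Real.exp (-m * l1 (q.1 - q.2)))) := by
  refine (summable_prod_of_nonneg fun q => ?_).2 ⟨fun w => ?_, ?_⟩
  · exact mul_nonneg (mul_nonneg hCM (Real.exp_pos _).le) (mul_nonneg hC (Real.exp_pos _).le)
  · have h : Summable (fun y : Site (d + 1) =>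
        (CM * Real.exp (-δ * l1 (p - (N : ℤ) • w))) * (C * Real.exp (-m * l1 (w - y)))) :=
      ((summable_exp_shift hm w).mul_left C).mul_left (CM * Real.exp (-δ * l1 (p - (N : ℤ) • w)))
    exact h
  · have e : ∀ w : Site (d + 1), (∑' y : Site (d + 1),
          (CM * Real.exp (-δ * l1 (p - (N : ℤ) • w))) * (C * Real.exp (-m * l1 (w - y))))
        = (CM * Real.exp (-δ * l1 (p - (N : ℤ) • w))) * (C * Zl (d + 1) m) := by
      intro w
      rw [tsum_mul_left, tsum_mul_left, tsum_exp_shift]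
    have h : Summable (fun w : Site (d + 1) => (CM * Real.exp (-δ * l1 (p - (N : ℤ) • w))) * (C * Zl (d + 1) m)) :=
      ((summable_exp_coarse hδ p).mul_left CM).mul_right _
    exact h.congr fun w => (e w).symm

/-- [folklore] **THE MULTIPLIER VERTEX HAS ZERO TOTAL BOND SUM (generic form).**  For a packed kernel `K` decaying at rate `m > 0` whose
multiplier columns have zero bond mass (`Σ_y colM K N μ y ρ w = 0` for all `μ ρ w` — fact (S2c), `GAN24/MultiplierZeroMass` for an4's step
kernel) and a multiplier table `M` whose entry `(x, z, a, b)` is enveloped by `CM·e^{−δ|p − N•w|₁}` in its coarse index (`δ > 0`, any centre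
`p`): `Σ'_y vertexOfM K N M μ y x z a b = 0`.  Proof: for each `ρ` the double family `(w, y) ↦ colM K N μ y ρ w · M ρ w x z a b` is
absolutely summable (envelope `CM e^{−δ|p−N•w|₁} · C e^{−m|w−y|₁}`); summing `y` first gives `0` fibrewise, summing `w` first gives the
`cwsum` of `vertexOfM` — `HasSum.prod_fiberwise` in both orders. -/
theorem hasSum_vertexOfM_bond_of_bound {K : MKer (d + 1) (Fib d)} {C m : ℝ} (hK : Decays K C m) (hm : 0 < m)
    (hK0 : ∀ μ ρ w, HasSum (fun y : Site (d + 1) => colM K N μ y ρ w) 0)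
    {M : Fin (d + 1) → Site (d + 1) → MKer (d + 1) (Fib d)} {x z : Site (d + 1)} {a b : Fib d} {CM δ : ℝ} (hCM : 0 ≤ CM)
    (hδ : 0 < δ) {p : Site (d + 1)} (hM : ∀ ρ w, |M ρ w x z a b| ≤ CM * Real.exp (-δ * l1 (p - (N : ℤ) • w))) (μ : Fin (d + 1)) :
    HasSum (fun y : Site (d + 1) => vertexOfM K N M μ y x z a b) 0 := by
  have hC : 0 ≤ C := hK.nonneg (Sum.inl 0)
  -- one multiplier direction `ρ` at a time
  have key : ∀ ρ : Fin (d + 1),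
      HasSum (fun y : Site (d + 1) => ∑' w : Site (d + 1), colM K N μ y ρ w * M ρ w x z a b) 0 := by
    intro ρ
    -- the double family, outer index `w`, is absolutely summable
    have hF_sum : Summable (fun q : Site (d + 1) × Site (d + 1) => colM K N μ q.2 ρ q.1 * M ρ q.1 x z a b) := by
      refine Summable.of_norm_bounded (summable_envelope (N := N) hC hm hCM hδ p) fun q => ?_
      rw [Real.norm_eq_abs, abs_mul, mul_comm (CM * _)]
      exact mul_le_mul (abs_colM_le_fine hK hm.le μ q.2 ρ q.1) (hM ρ q.1) (abs_nonneg _)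
        (mul_nonneg hC (Real.exp_pos _).le)
    -- summing `y` first: every fibre is `0`, so the total is `0`
    have h0 : HasSum (fun _ : Site (d + 1) => (0 : ℝ))
        (∑' q : Site (d + 1) × Site (d + 1), colM K N μ q.2 ρ q.1 * M ρ q.1 x z a b) := by
      refine hF_sum.hasSum.prod_fiberwise fun w => ?_
      have h := (hK0 μ ρ w).mul_right (M ρ w x z a b)
      rw [zero_mul] at h
      exact h
    have htot : ∑' q : Site (d + 1) × Site (d + 1), colM K N μ q.2 ρ q.1 * M ρ q.1 x z a b = 0 := h0.unique hasSum_zero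
    -- summing `w` first: the fibres are the coarse superpositions
    have hF' := (Equiv.hasSum_iff (Equiv.prodComm (Site (d + 1)) (Site (d + 1)))).mpr hF_sum.hasSum
    have hS' := (Equiv.summable_iff (Equiv.prodComm (Site (d + 1)) (Site (d + 1)))).mpr hF_sum
    have h1 := hF'.prod_fiberwise fun y => (hS'.prod_factor y).hasSum
    rw [htot] at h1
    refine h1.congr_fun fun y => ?_
    rfl
  -- assemble over `ρ`
  have hsum := hasSum_sum (s := (Finset.univ : Finset (Fin (d + 1)))) fun ρ _ => key ρ
  rw [Finset.sum_const_zero] at hsum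
  refine hsum.congr_fun fun y => ?_
  simp only [vertexOfM, cwsum_apply]

/-- [folklore] **ZERO BOND SUM OF THE MULTIPLIER VERTEX for a `VertexFamily` table** (an2's `M1 = cΛ • hessFF`-shaped tables: bi-localised at
the coarse point `N•w`). -/
theorem hasSum_vertexOfM_bond {K : MKer (d + 1) (Fib d)} {C m : ℝ} (hK : Decays K C m) (hm : 0 < m)
    (hK0 : ∀ μ ρ w, HasSum (fun y : Site (d + 1) => colM K N μ y ρ w) 0)
    {M : Fin (d + 1) → Site (d + 1) → MKer (d + 1) (Fib d)} {CM δ : ℝ} (hM : VertexFamily M N CM δ) (hδ : 0 < δ)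
    (μ : Fin (d + 1)) (x z : Site (d + 1)) (a b : Fib d) :
    HasSum (fun y : Site (d + 1) => vertexOfM K N M μ y x z a b) 0 := by
  have hCM : 0 ≤ CM := (hM 0 0).nonneg (Sum.inl 0)
  refine hasSum_vertexOfM_bond_of_bound hK hm hK0 (CM := CM) hCM hδ (p := x) (fun ρ w => ?_) μ
  refine (hM ρ w x z a b).trans (mul_le_mul_of_nonneg_left ?_ hCM)
  rw [Real.exp_le_exp]
  nlinarith [l1_nonneg (z - (N : ℤ) • w), l1_nonneg (x - (N : ℤ) • w)]

/-- [folklore] **ZERO BOND SUM OF THE MULTIPLIER VERTEX for the `(κ, u)`-SLICE of a `LocStencilFM` table** (the mixed table inside an2's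
`mixOfK`: its slice `M₂ κ u` is bi-localised at the fine bond `u` with constant `C₂·e^{−δ|u − N•w|₁}`). -/
theorem hasSum_vertexOfM_bond_locStencilFM {K : MKer (d + 1) (Fib d)} {C m : ℝ} (hK : Decays K C m) (hm : 0 < m)
    (hK0 : ∀ μ ρ w, HasSum (fun y : Site (d + 1) => colM K N μ y ρ w) 0)
    {M₂ : Fin (d + 1) → Site (d + 1) → Fin (d + 1) → Site (d + 1) → MKer (d + 1) (Fib d)} {C₂ δ : ℝ}
    (hM₂ : LocStencilFM N M₂ C₂ δ) (hδ : 0 < δ) (κ : Fin (d + 1)) (u : Site (d + 1))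
    (μ : Fin (d + 1)) (x z : Site (d + 1)) (a b : Fib d) :
    HasSum (fun y : Site (d + 1) => vertexOfM K N (M₂ κ u) μ y x z a b) 0 := by
  have hC₂ : 0 ≤ C₂ := hM₂.nonneg
  refine hasSum_vertexOfM_bond_of_bound hK hm hK0 (CM := C₂) hC₂ hδ (p := u) (fun ρ w => ?_) μ
  have h := hM₂ κ u ρ w x z a b
  refine h.trans ?_
  have he : Real.exp (-δ * (l1 (x - u) + l1 (z - u))) ≤ 1 := by
    rw [Real.exp_le_one_iff]
    nlinarith [l1_nonneg (x - u), l1_nonneg (z - u)]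
  have h0 : 0 ≤ C₂ * Real.exp (-δ * l1 (u - (N : ℤ) • w)) := by positivity
  calc C₂ * Real.exp (-δ * l1 (u - (N : ℤ) • w)) * Real.exp (-δ * (l1 (x - u) + l1 (z - u)))
      ≤ C₂ * Real.exp (-δ * l1 (u - (N : ℤ) • w)) * 1 := mul_le_mul_of_nonneg_left he h0
    _ = C₂ * Real.exp (-δ * l1 (u - (N : ℤ) • w)) := mul_one _

/-- [folklore] `tsum` form for `VertexFamily` tables. -/
theorem tsum_vertexOfM_bond {K : MKer (d + 1) (Fib d)} {C m : ℝ} (hK : Decays K C m) (hm : 0 < m)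
    (hK0 : ∀ μ ρ w, HasSum (fun y : Site (d + 1) => colM K N μ y ρ w) 0)
    {M : Fin (d + 1) → Site (d + 1) → MKer (d + 1) (Fib d)} {CM δ : ℝ} (hM : VertexFamily M N CM δ) (hδ : 0 < δ)
    (μ : Fin (d + 1)) (x z : Site (d + 1)) (a b : Fib d) :
    ∑' y : Site (d + 1), vertexOfM K N M μ y x z a b = 0 :=
  (hasSum_vertexOfM_bond hK hm hK0 hM hδ μ x z a b).tsum_eq

end Generic

/-! ## §2 The step instances: an4's `KInvStep Lc j`, raw and in the wall's units -/

section Step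

variable {Lc : ℕ} [NeZero Lc]

/-- [folklore] **(S2c) ⇒ THE MULTIPLIER VERTEX THROUGH THE STEP KERNEL HAS ZERO BOND SUM**: for every `VertexFamily` table `M` at a positive
rate, `Σ'_y vertexOfM (KInvStep Lc j) Lc M μ y x z a b = 0`. -/
theorem hasSum_vertexOfM_KInvStep_bond (j : ℕ) {M : Fin (d + 1) → Site (d + 1) → MKer (d + 1) (Fib d)} {CM δ : ℝ}
    (hM : VertexFamily M Lc CM δ) (hδ : 0 < δ) (μ : Fin (d + 1)) (x z : Site (d + 1)) (a b : Fib d) :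
    HasSum (fun y : Site (d + 1) => vertexOfM (KInvStep (d := d) Lc j) Lc M μ y x z a b) 0 := by
  obtain ⟨m, C, hm, _, hK⟩ := decays_KInvStep (d := d) (Lc := Lc) j
  exact hasSum_vertexOfM_bond hK hm (fun μ ρ w => hasSum_colM_KInvStep_bond j μ ρ w) hM hδ μ x z a b

/-- [folklore] … and for the `(κ, u)`-slices of a `LocStencilFM` table. -/
theorem hasSum_vertexOfM_KInvStep_bond_locStencilFM (j : ℕ)
    {M₂ : Fin (d + 1) → Site (d + 1) → Fin (d + 1) → Site (d + 1) → MKer (d + 1) (Fib d)} {C₂ δ : ℝ}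
    (hM₂ : LocStencilFM Lc M₂ C₂ δ) (hδ : 0 < δ) (κ : Fin (d + 1)) (u : Site (d + 1))
    (μ : Fin (d + 1)) (x z : Site (d + 1)) (a b : Fib d) :
    HasSum (fun y : Site (d + 1) => vertexOfM (KInvStep (d := d) Lc j) Lc (M₂ κ u) μ y x z a b) 0 := by
  obtain ⟨m, C, hm, _, hK⟩ := decays_KInvStep (d := d) (Lc := Lc) j
  exact hasSum_vertexOfM_bond_locStencilFM hK hm (fun μ ρ w => hasSum_colM_KInvStep_bond j μ ρ w) hM₂ hδ κ u μ x z a b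

/-- [folklore] **THE DRESSED STEP KERNEL** `unitK s_f s_m (KInvStep Lc j)` (the wall's `K♮_j` at `s_f = sfStep Lc j`, `s_m = smStep d Lc j`; any real
units here): zero bond sum of the multiplier vertex for every `VertexFamily` table. -/
theorem hasSum_vertexOfM_unitK_KInvStep_bond (sf sm : ℝ) (j : ℕ) {M : Fin (d + 1) → Site (d + 1) → MKer (d + 1) (Fib d)}
    {CM δ : ℝ} (hM : VertexFamily M Lc CM δ) (hδ : 0 < δ) (μ : Fin (d + 1)) (x z : Site (d + 1)) (a b : Fib d) :
    HasSum (fun y : Site (d + 1) => vertexOfM (unitK sf sm (KInvStep (d := d) Lc j)) Lc M μ y x z a b) 0 := by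
  obtain ⟨m, C, hm, _, hK⟩ := decays_KInvStep (d := d) (Lc := Lc) j
  exact hasSum_vertexOfM_bond (decays_unitK (sf := sf) (sm := sm) hK) hm
    (fun μ ρ w => hasSum_colM_unitK_KInvStep_bond sf sm j μ ρ w) hM hδ μ x z a b

/-- [folklore] … and for the `(κ, u)`-slices of a `LocStencilFM` table. -/
theorem hasSum_vertexOfM_unitK_KInvStep_bond_locStencilFM (sf sm : ℝ) (j : ℕ)
    {M₂ : Fin (d + 1) → Site (d + 1) → Fin (d + 1) → Site (d + 1) → MKer (d + 1) (Fib d)} {C₂ δ : ℝ}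
    (hM₂ : LocStencilFM Lc M₂ C₂ δ) (hδ : 0 < δ) (κ : Fin (d + 1)) (u : Site (d + 1))
    (μ : Fin (d + 1)) (x z : Site (d + 1)) (a b : Fib d) :
    HasSum (fun y : Site (d + 1) => vertexOfM (unitK sf sm (KInvStep (d := d) Lc j)) Lc (M₂ κ u) μ y x z a b) 0 := by
  obtain ⟨m, C, hm, _, hK⟩ := decays_KInvStep (d := d) (Lc := Lc) j
  exact hasSum_vertexOfM_bond_locStencilFM (decays_unitK (sf := sf) (sm := sm) hK) hm
    (fun μ ρ w => hasSum_colM_unitK_KInvStep_bond sf sm j μ ρ w) hM₂ hδ κ u μ x z a b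

/-- [folklore] `tsum` form of the raw step instance. -/
theorem tsum_vertexOfM_KInvStep_bond (j : ℕ) {M : Fin (d + 1) → Site (d + 1) → MKer (d + 1) (Fib d)} {CM δ : ℝ}
    (hM : VertexFamily M Lc CM δ) (hδ : 0 < δ) (μ : Fin (d + 1)) (x z : Site (d + 1)) (a b : Fib d) :
    ∑' y : Site (d + 1), vertexOfM (KInvStep (d := d) Lc j) Lc M μ y x z a b = 0 :=
  (hasSum_vertexOfM_KInvStep_bond j hM hδ μ x z a b).tsum_eq

end Step

end Summit.QuantumFields.BalabanUV.Beta.GAN24.MultiplierVertexBondSum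

end
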